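import Literature.Analysis.FluidPDE.ForwardDSSLocalEnergyCubic
import HarnessLib

/-!
# Forward DSS solutions: the local term `−⅓ (η_{ε√s} * v_ε)·v_ε` of the pressure (3.8),
Bradshaw–Tsai 2019, p. 9

Analysis/FluidPDE proof file (theorems only) in the decomposition of
`Literature.Analysis.FluidPDE.bradshawTsai2019_prop_3_1` (Bradshaw–Tsai, Analysis & PDE 12
(2019) = arXiv:1801.08060, Prop. 3.1; the remaining analytic input is the a priori estimate
(3.12), cf. `bradshawTsai2019_prop_3_1_approximation` in `ForwardDSSLocalEnergyLimit`). The first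
term of the pressure formula (3.8) is bounded in print by

> "Bounding the first term from (3.8) is simple given Hölder's inequality, (3.10), and (3.11). In
> particular, we have for any `γ > 0`
> `∫₀ᵗ ‖⅓|(η_{ε√s} * v_ε)(·,s)||v_ε(·,s)|‖^{3/2}_{L^{3/2}(B_λ)} ds
>   ≤ C(λ,γ,η)∫₀ᵗ(α̃_ε(s)³ + α̃_ε(s)) ds + γ∫₀ᵗ∫|∇v_ε|²φ dx ds`." (p. 9)

This file proves it in the `ℝ≥0∞` bookkeeping of `ForwardDSSLocalEnergy`, from the accepted
bricks of `ForwardDSSLocalEnergyCubic` ((3.10) with `q = 3`, the re-scaling (3.6) of cubic masses,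
and the Gagliardo–Nirenberg step integrated in time):

* `setLIntegral_cylinder_cube_add_drift_cube_le`:
  `∫∫_{(0,t)×B_λ} (|w|³ + |b|³) ≤ (λ² + λ⁴) ∫∫_{(0,t)×B₁} |w|³` (`b = η_{ε√s} * w`, `0 < t ≤ 1`);
* `setLIntegral_cylinder_inner_drift_rpow_le_supBallEnergy`: for every `γ ∈ (0,∞)` a constant
  `C < ∞` with `∫∫_{(0,t)×B_λ} |⟨b, w⟩|^{3/2} ≤ C ∫₀ᵗ (α̃³ + α̃) + γ ∫∫_{(0,t)×ℝ³} χ²|H|²`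
  (`|⟨b,w⟩|^{3/2} ≤ (|b||w|)^{3/2} ≤ |b|³ + |w|³`; the factor `(⅓)^{3/2} ≤ 1` is dropped).

## References

* Z. Bradshaw, T.-P. Tsai, Analysis & PDE 12 (2019) 1943–1962 = arXiv:1801.08060, §3, proof of
  Prop. 3.1, the bound for the first term of (3.8), p. 9 [BradshawTsai2019].
-/

noncomputable section

open MeasureTheory Set Function Filter Metric Module
open scoped NNReal ENNReal Topology RealInnerProductSpace

namespace Literature.Analysis.FluidPDE

namespace BradshawTsai2019

/-! ## A pointwise inequality -/

/-- `(xy)^{3/2} ≤ x³ + y³` in `ℝ≥0∞` (crude form of `2(xy)^{3/2} ≤ x³ + y³`: if `x ≤ y` the left side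
is at most `y³`, otherwise at most `x³`). [folklore] -/
theorem mul_rpow_three_halves_le_add (x y : ℝ≥0∞) :
    (x * y) ^ (3 / 2 : ℝ) ≤ x ^ (3 : ℝ) + y ^ (3 : ℝ) := by
  have key : ∀ {a b : ℝ≥0∞}, a ≤ b → (a * b) ^ (3 / 2 : ℝ) ≤ b ^ (3 : ℝ) := by
    intro a b hab
    calc (a * b) ^ (3 / 2 : ℝ) ≤ (b * b) ^ (3 / 2 : ℝ) :=
          ENNReal.rpow_le_rpow (mul_le_mul' hab le_rfl) (by norm_num)
      _ = b ^ (3 : ℝ) := by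
          rw [← sq, ← ENNReal.rpow_natCast, ← ENNReal.rpow_mul]; norm_num
  rcases le_total x y with h | h
  · exact (key h).trans le_add_self
  · rw [mul_comm]; exact (key h).trans le_self_add

/-! ## The cubic masses of `w` and of its drift on `(0,t) × B_λ` -/

section Cubic

variable {E : Type*} [NormedAddCommGroup E] [InnerProductSpace ℝ E] [FiniteDimensional ℝ E]
  [MeasurableSpace E] [BorelSpace E]

/-- **The cubic masses on `B_λ`** (Bradshaw–Tsai 2019, p. 9, the two steps behind (3.11)): for the
drift `b = η_{ε√s} * w` of a `λ`-DSS field `w` continuous on the open slab (`ερ ≤ λ − 1`) and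
`0 < t ≤ 1`,
`∫∫_{(0,t)×B_λ} |w|³ + ∫∫_{(0,t)×B_λ} |b|³ ≤ (λ² + λ⁴) ∫∫_{(0,t)×B₁} |w|³`
((3.10) with `q = 3` slice-wise sends the drift to `B_{λ²}`; the space–time scaling law (3.6)
sends `B_λ`, `B_{λ²}` to `B₁` with `λ²`, `λ⁴`, enlarging the time interval). [cite: BradshawTsai2019, §3 (3.10)–(3.11)] -/
theorem setLIntegral_cylinder_cube_add_drift_cube_le {c : ℝ} (hc : 1 < c) {η : E → ℝ}
    (hηc : Continuous η) (hη0 : ∀ y, 0 ≤ η y) (hη1 : ∫ y, η y = 1) {ρ : ℝ}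
    (hηρ : ∀ y, ρ ≤ ‖y‖ → η y = 0) {ε : ℝ} (hε : 0 < ε) (hερ : ε * ρ ≤ c - 1)
    (hE : finrank ℝ E = 3) {w : ℝ → E → E} (hw : IsDiscretelySelfSimilar c w)
    (hwm : ContinuousOn (uncurry w) (Ioi (0 : ℝ) ×ˢ (univ : Set E))) {t : ℝ} (ht0 : 0 < t)
    (ht1 : t ≤ 1) :
    (∫⁻ z in Ioo (0 : ℝ) t ×ˢ ball (0 : E) c, ‖w z.1 z.2‖ₑ ^ (3 : ℝ)) +
        ∫⁻ z in Ioo (0 : ℝ) t ×ˢ ball (0 : E) c, ‖mollifiedDrift η ε w z.1 z.2‖ₑ ^ (3 : ℝ) ≤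
      (ENNReal.ofReal (c ^ 2) + ENNReal.ofReal (c ^ 4)) *
        ∫⁻ z in Ioo (0 : ℝ) t ×ˢ ball (0 : E) 1, ‖w z.1 z.2‖ₑ ^ (3 : ℝ) := by
  have hc0 : 0 < c := zero_lt_one.trans hc
  have hc2 : 1 < c ^ 2 := one_lt_pow₀ hc two_ne_zero
  have hW3 : ∀ S : Set E, MeasurableSet S → AEMeasurable (fun z : ℝ × E => ‖w z.1 z.2‖ₑ ^ (3 : ℝ))
      (volume.restrict (Ioo (0 : ℝ) t ×ˢ S)) := fun S hS =>
    ((aestronglyMeasurable_restrict_of_continuousOn hwm t hS).enorm.pow_const _)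
  -- (3.10) slice-wise, integrated
  have hB : ∫⁻ z in Ioo (0 : ℝ) t ×ˢ ball (0 : E) c, ‖mollifiedDrift η ε w z.1 z.2‖ₑ ^ (3 : ℝ) ≤
      ∫⁻ z in Ioo (0 : ℝ) t ×ˢ ball (0 : E) (c ^ 2), ‖w z.1 z.2‖ₑ ^ (3 : ℝ) := by
    calc ∫⁻ z in Ioo (0 : ℝ) t ×ˢ ball (0 : E) c, ‖mollifiedDrift η ε w z.1 z.2‖ₑ ^ (3 : ℝ)
        ≤ ∫⁻ s in Ioo (0 : ℝ) t, ∫⁻ x in ball (0 : E) c, ‖mollifiedDrift η ε w s x‖ₑ ^ (3 : ℝ) :=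
          setLIntegral_cylinder_le_iterate _ t _
      _ ≤ ∫⁻ s in Ioo (0 : ℝ) t, ∫⁻ x in ball (0 : E) (c ^ 2), ‖w s x‖ₑ ^ (3 : ℝ) := by
          refine setLIntegral_mono' measurableSet_Ioo fun s hs => ?_
          have h := setLIntegral_ball_pow_enorm_mollifiedDrift_rpow_le (F := E) hc hηc hη0 hη1 hηρ
            hε hερ hs.1 (hs.2.le.trans ht1)
            (continuous_slice_of_continuousOn hwm hs.1).aestronglyMeasurable
            (q := 3) (by norm_num) 1
          rwa [pow_one, show (1 + 1 : ℕ) = 2 from rfl] at h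
      _ = ∫⁻ z in Ioo (0 : ℝ) t ×ˢ ball (0 : E) (c ^ 2), ‖w z.1 z.2‖ₑ ^ (3 : ℝ) :=
          (setLIntegral_cylinder_eq_iterate (hW3 _ measurableSet_ball)).symm
  -- the space–time scaling law (3.6) for `γ = λ` and `γ = λ²`
  have hscale : ∀ {γ : ℝ}, 1 < γ → IsDiscretelySelfSimilar γ w →
      ∫⁻ z in Ioo 0 t ×ˢ ball (0 : E) γ, ‖w z.1 z.2‖ₑ ^ (3 : ℝ) ≤
        ENNReal.ofReal (γ ^ 2) * ∫⁻ z in Ioo (0 : ℝ) t ×ˢ ball (0 : E) 1, ‖w z.1 z.2‖ₑ ^ (3 : ℝ) := by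
    intro γ hγ hwγ
    have hγ0 : 0 < γ := zero_lt_one.trans hγ
    have key := setLIntegral_cylinder_enorm_rpow_eq_of_dss (E := E) (F := E) hγ0 hwγ
      (by norm_num : (0 : ℝ) ≤ 3) 1 t
    rw [hE, mul_one] at key
    have hconst : ‖γ‖ₑ ^ (3 : ℝ) * ENNReal.ofReal (γ * γ * γ ^ 3)⁻¹ = (ENNReal.ofReal (γ ^ 2))⁻¹ := by
      rw [Real.enorm_eq_ofReal hγ0.le, ENNReal.ofReal_rpow_of_nonneg hγ0.le (by norm_num),
        show ((3 : ℝ)) = ((3 : ℕ) : ℝ) by norm_num, Real.rpow_natCast,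
        ← ENNReal.ofReal_mul (by positivity), ← ENNReal.ofReal_inv_of_pos (by positivity)]
      congr 1
      field_simp
    rw [hconst] at key
    have h2 : ENNReal.ofReal (γ ^ 2) ≠ 0 := (ENNReal.ofReal_pos.2 (by positivity)).ne'
    have e : ∫⁻ z in Ioo 0 t ×ˢ ball (0 : E) γ, ‖w z.1 z.2‖ₑ ^ (3 : ℝ) =
        ENNReal.ofReal (γ ^ 2) *
          ∫⁻ z in Ioo 0 ((γ ^ 2)⁻¹ * t) ×ˢ ball (0 : E) 1, ‖w z.1 z.2‖ₑ ^ (3 : ℝ) := by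
      rw [key, ← mul_assoc, ENNReal.mul_inv_cancel h2 ENNReal.ofReal_ne_top, one_mul]
    rw [e]
    refine mul_le_mul' le_rfl (lintegral_mono_set (prod_mono (Ioo_subset_Ioo le_rfl ?_) Subset.rfl))
    have h1 : (γ ^ 2)⁻¹ ≤ 1 := inv_le_one_of_one_le₀ (one_le_pow₀ hγ.le)
    calc (γ ^ 2)⁻¹ * t ≤ 1 * t := mul_le_mul_of_nonneg_right h1 ht0.le
      _ = t := one_mul t
  have hA := hscale hc hw
  have hB' : ∫⁻ z in Ioo (0 : ℝ) t ×ˢ ball (0 : E) (c ^ 2), ‖w z.1 z.2‖ₑ ^ (3 : ℝ) ≤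
      ENNReal.ofReal (c ^ 4) * ∫⁻ z in Ioo (0 : ℝ) t ×ˢ ball (0 : E) 1, ‖w z.1 z.2‖ₑ ^ (3 : ℝ) := by
    have h := hscale hc2 (isDiscretelySelfSimilar_pow hw 2)
    rwa [show (c ^ 2) ^ 2 = c ^ 4 by ring] at h
  calc (∫⁻ z in Ioo (0 : ℝ) t ×ˢ ball (0 : E) c, ‖w z.1 z.2‖ₑ ^ (3 : ℝ)) +
        ∫⁻ z in Ioo (0 : ℝ) t ×ˢ ball (0 : E) c, ‖mollifiedDrift η ε w z.1 z.2‖ₑ ^ (3 : ℝ)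
      ≤ ENNReal.ofReal (c ^ 2) * (∫⁻ z in Ioo (0 : ℝ) t ×ˢ ball (0 : E) 1, ‖w z.1 z.2‖ₑ ^ (3 : ℝ)) +
          ENNReal.ofReal (c ^ 4) * ∫⁻ z in Ioo (0 : ℝ) t ×ˢ ball (0 : E) 1, ‖w z.1 z.2‖ₑ ^ (3 : ℝ) :=
        add_le_add hA (hB.trans hB')
    _ = (ENNReal.ofReal (c ^ 2) + ENNReal.ofReal (c ^ 4)) *
          ∫⁻ z in Ioo (0 : ℝ) t ×ˢ ball (0 : E) 1, ‖w z.1 z.2‖ₑ ^ (3 : ℝ) := (add_mul _ _ _).symm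

end Cubic

/-! ## The local term of the pressure (`E = ℝ³`) -/

section R3

variable {c : ℝ} {w : ℝ → EuclideanSpace ℝ (Fin 3) → EuclideanSpace ℝ (Fin 3)}
  {H : ℝ → EuclideanSpace ℝ (Fin 3) → EuclideanSpace ℝ (Fin 3) →L[ℝ] EuclideanSpace ℝ (Fin 3)}
  {χ : EuclideanSpace ℝ (Fin 3) → ℝ}

/-- **Bradshaw–Tsai 2019, p. 9: the local term of the pressure.** For every `γ ∈ (0,∞)` there is
`C < ∞` (depending on `λ`, the cut-off and `γ`) such that for `0 < t ≤ 1`,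
`∫∫_{(0,t)×B_λ} |⟨η_{ε√s} * w, w⟩|^{3/2} ≤ C ∫₀ᵗ (α̃³ + α̃) + γ ∫∫_{(0,t)×ℝ³} χ²|H|²`
("Bounding the first term from (3.8) is simple given Hölder's inequality, (3.10), and (3.11) …
`∫₀ᵗ‖⅓|(η_{ε√s} * v_ε)||v_ε|‖^{3/2}_{L^{3/2}(B_λ)} ≤ C(λ,γ,η)∫₀ᵗ(α̃³ + α̃) + γ∫₀ᵗ∫|∇v_ε|²φ`"; the
factor `(⅓)^{3/2} ≤ 1` is dropped). Hypotheses as in `ForwardDSSLocalEnergyCubic`. [cite: BradshawTsai2019, §3 p. 9 (first term of (3.8))] -/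
theorem setLIntegral_cylinder_inner_drift_rpow_le_supBallEnergy (hc : 1 < c)
    {η : EuclideanSpace ℝ (Fin 3) → ℝ} (hηc : Continuous η) (hη0 : ∀ y, 0 ≤ η y)
    (hη1 : ∫ y, η y = 1) {ρ : ℝ} (hηρ : ∀ y, ρ ≤ ‖y‖ → η y = 0) {ε : ℝ} (hε : 0 < ε)
    (hερ : ε * ρ ≤ c - 1) (hw : IsDiscretelySelfSimilar c w)
    (hwm : ContinuousOn (uncurry w) (Ioi (0 : ℝ) ×ˢ (univ : Set (EuclideanSpace ℝ (Fin 3)))))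
    (hws : ∀ s, 0 < s → ContDiff ℝ 1 (w s))
    (hH : ∀ s, 0 < s → ∀ x, H s x = fderiv ℝ (w s) x)
    (hHm : ContinuousOn (uncurry H) (Ioi (0 : ℝ) ×ˢ (univ : Set (EuclideanSpace ℝ (Fin 3)))))
    (hχ : ContDiff ℝ 1 χ) (hχ1 : ∀ x, |χ x| ≤ 1) {M : ℝ} (hM : ∀ x, ‖fderiv ℝ χ x‖ ≤ M)
    (hχc : ∀ x, c ≤ ‖x‖ → χ x = 0) (hχB : ∀ x ∈ ball (0 : EuclideanSpace ℝ (Fin 3)) 1, χ x = 1)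
    {γ : ℝ≥0∞} (hγ0 : γ ≠ 0) (hγt : γ ≠ ⊤) :
    ∃ C : ℝ≥0∞, C ≠ ⊤ ∧ ∀ t : ℝ, 0 < t → t ≤ 1 →
      ∫⁻ z in Ioo (0 : ℝ) t ×ˢ ball (0 : EuclideanSpace ℝ (Fin 3)) c,
          ‖⟪mollifiedDrift η ε w z.1 z.2, w z.1 z.2⟫‖ₑ ^ (3 / 2 : ℝ) ≤
        C * (∫⁻ s in Ioo (0 : ℝ) t, (supBallEnergy w s ^ 3 + supBallEnergy w s)) +
          γ * ∫⁻ z in Ioo (0 : ℝ) t ×ˢ (univ : Set (EuclideanSpace ℝ (Fin 3))),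
            ENNReal.ofReal (χ z.2 ^ 2 * frobeniusNormSq (H z.1 z.2)) := by
  set L : ℝ≥0∞ := ENNReal.ofReal (c ^ 2) + ENNReal.ofReal (c ^ 4) with hL
  have hL0 : L ≠ 0 :=
    (lt_of_lt_of_le (ENNReal.ofReal_pos.2 (by positivity : (0 : ℝ) < c ^ 2)) le_self_add).ne'
  have hLt : L ≠ ⊤ := ENNReal.add_ne_top.2 ⟨ENNReal.ofReal_ne_top, ENNReal.ofReal_ne_top⟩
  have hγ'0 : γ / L ≠ 0 := by
    rw [Ne, ENNReal.div_eq_zero_iff]; push Not; exact ⟨hγ0, hLt⟩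
  have hγ't : γ / L ≠ ⊤ := ENNReal.div_ne_top hγt hL0
  obtain ⟨C, hCt, hGN⟩ := setLIntegral_unitCylinder_cube_le hc hw hws hH hHm hχ hχ1 hM hχc hχB
    hγ'0 hγ't
  refine ⟨L * C, ENNReal.mul_ne_top hLt hCt, fun t ht0 ht1 => ?_⟩
  have hwm3 : AEMeasurable (fun z : ℝ × EuclideanSpace ℝ (Fin 3) => ‖w z.1 z.2‖ₑ ^ (3 : ℝ))
      (volume.restrict (Ioo (0 : ℝ) t ×ˢ ball (0 : EuclideanSpace ℝ (Fin 3)) c)) :=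
    (aestronglyMeasurable_restrict_of_continuousOn hwm t measurableSet_ball).enorm.pow_const _
  calc ∫⁻ z in Ioo (0 : ℝ) t ×ˢ ball (0 : EuclideanSpace ℝ (Fin 3)) c,
          ‖⟪mollifiedDrift η ε w z.1 z.2, w z.1 z.2⟫‖ₑ ^ (3 / 2 : ℝ)
      ≤ ∫⁻ z in Ioo (0 : ℝ) t ×ˢ ball (0 : EuclideanSpace ℝ (Fin 3)) c,
          (‖w z.1 z.2‖ₑ ^ (3 : ℝ) + ‖mollifiedDrift η ε w z.1 z.2‖ₑ ^ (3 : ℝ)) := by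
        refine lintegral_mono fun z => ?_
        calc ‖⟪mollifiedDrift η ε w z.1 z.2, w z.1 z.2⟫‖ₑ ^ (3 / 2 : ℝ)
            ≤ (‖mollifiedDrift η ε w z.1 z.2‖ₑ * ‖w z.1 z.2‖ₑ) ^ (3 / 2 : ℝ) := by
              refine ENNReal.rpow_le_rpow ?_ (by norm_num)
              rw [← ofReal_norm, ← ofReal_norm, ← ofReal_norm, ← ENNReal.ofReal_mul (norm_nonneg _)]
              exact ENNReal.ofReal_le_ofReal (norm_inner_le_norm _ _)
          _ ≤ ‖mollifiedDrift η ε w z.1 z.2‖ₑ ^ (3 : ℝ) + ‖w z.1 z.2‖ₑ ^ (3 : ℝ) :=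
              mul_rpow_three_halves_le_add _ _
          _ = ‖w z.1 z.2‖ₑ ^ (3 : ℝ) + ‖mollifiedDrift η ε w z.1 z.2‖ₑ ^ (3 : ℝ) := add_comm _ _
    _ = (∫⁻ z in Ioo (0 : ℝ) t ×ˢ ball (0 : EuclideanSpace ℝ (Fin 3)) c, ‖w z.1 z.2‖ₑ ^ (3 : ℝ)) +
          ∫⁻ z in Ioo (0 : ℝ) t ×ˢ ball (0 : EuclideanSpace ℝ (Fin 3)) c,
            ‖mollifiedDrift η ε w z.1 z.2‖ₑ ^ (3 : ℝ) := lintegral_add_left' hwm3 _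
    _ ≤ L * ∫⁻ z in Ioo (0 : ℝ) t ×ˢ ball (0 : EuclideanSpace ℝ (Fin 3)) 1, ‖w z.1 z.2‖ₑ ^ (3 : ℝ) :=
        setLIntegral_cylinder_cube_add_drift_cube_le hc hηc hη0 hη1 hηρ hε hερ
          finrank_euclideanSpace_fin hw hwm ht0 ht1
    _ ≤ L * (C * (∫⁻ s in Ioo (0 : ℝ) t, (supBallEnergy w s ^ 3 + supBallEnergy w s)) +
          γ / L * ∫⁻ z in Ioo (0 : ℝ) t ×ˢ (univ : Set (EuclideanSpace ℝ (Fin 3))),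
            ENNReal.ofReal (χ z.2 ^ 2 * frobeniusNormSq (H z.1 z.2))) :=
        mul_le_mul' le_rfl (hGN t ht0)
    _ = L * C * (∫⁻ s in Ioo (0 : ℝ) t, (supBallEnergy w s ^ 3 + supBallEnergy w s)) +
          γ * ∫⁻ z in Ioo (0 : ℝ) t ×ˢ (univ : Set (EuclideanSpace ℝ (Fin 3))),
            ENNReal.ofReal (χ z.2 ^ 2 * frobeniusNormSq (H z.1 z.2)) := by
        rw [mul_add, ← mul_assoc, ← mul_assoc, ENNReal.mul_div_cancel hL0 hLt]

end R3

end BradshawTsai2019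

end Literature.Analysis.FluidPDE

end
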